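import Literature.AlgebraicGeometry.Modules.CechFullPullbackScalingCoboundary
import Literature.AlgebraicGeometry.Modules.CechFullCochainRawReading
import Literature.AlgebraicGeometry.AbelianSchemes.AbelianVarietyDiagonalCoverMulTwo
import Literature.AlgebraicGeometry.Morphisms.CechModuleH2RefinementInjective
import Literature.AlgebraicGeometry.Morphisms.CechModuleH2RefinementIndependence
import Literature.AlgebraicGeometry.Morphisms.CechModuleH2RefinementLemmas
import Literature.AlgebraicGeometry.Modules.CechPullbackSystemHom
import Literature.AlgebraicGeometry.Modules.LinearOverBase
import Literature.AlgebraicGeometry.Modules.AffineLocalizing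
import Literature.AlgebraicGeometry.Morphisms.FormalFunctions
import HarnessLib

/-!
# Transport of a pull-back scaling identity `[g^* z] = c₀ • [z]` on `Ȟ²(𝒪_X)` from the ORDERED module Čech complex of a finite
# affine subcover to the RAW module Čech classes of every pair of refining families
# (The Stacks Project, Tags 01FG, 01FM, 01XD; Görtz–Wedhorn II, Thm. 22.9)

Layer `Literature/AlgebraicGeometry/Morphisms`; namespaces `Literature.AlgebraicGeometry.Modules` (§1, read-outs) and
`Literature.AlgebraicGeometry.Morphisms` (§2).  PROOF file (theorems only: no definition, no instance, no notation, no named fact,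
no `sorry`).  Cell `hodgecm-mathlib` FLOOR 0, P1 sub-line F-11, MONO-G1 slot (5) `hrel₃` («`[2]^* = 4` on `Ȟ²(𝒪)`» of the
abelian-variety closed fibre), road N1–N4 (F0P1b-plan (g2) (R109)): this is N4, the ASSEMBLY, generic in the `A`-scheme `X`, the
endomorphism `g` and the scalar `c₀` (the pin `X := A₀ ×_(A∕J) k`, `g := [2]`, `c₀ := 2·2` is a one-line instance over N1, filed apart).
HC_CM is proved only modulo the 7 printed citations until rung 0 closes — nothing here bears on a summit statement.

* §1 read-outs pending the sibling `Modules/CechFullCochainRawPullbackCompat` (F0P1c-p03 (g3)): the pull-back of FULL cochains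
  ★ `Full.pullbackCochain θ (pullbackSystemHom g …)` READS the refined raw pull-back `ρ_θ (g^* s)` (`map_toRing_pullbackCochain_eq_refineC2_comapC2`)
  and, along `𝟙`, the raw refinement (`map_toRing_pullbackCochain_id_eq_refineC2`); `rawTwo_sub_smul`, `mem_cechMB2_of_forall_eq_of_full_d`
  (corollaries of ★ `Modules/CechFullCochainRawReading`);
* §2 **`CechMH2.mk_refineC2_comapC2_eq_smul_of_ordered`** — for `X → Spec A` separated with `X` compact, `g : X → X` over `A`, `c₀ ∈ A`,
  an affine open cover `𝓤` and a raw `2`-cocycle `z` of `𝒪` on `𝓤`: IF for every finite subfamily `𝓥 = 𝓤 ∘ e` covering `X` and every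
  diagonal family `WΔ ((i,j),l) = V_i ∩ V_j ∩ g⁻¹V_l` (★ `AbelianSchemes.exists_diagonalCover`) the ORDERED module Čech classes satisfy
  `H²(g^♯_{↦l}) x = c₀ • H²(ref_{↦i}) x` in `Ȟ²(WΔ, 𝒪)` for all `x ∈ Ȟ²(𝓥, 𝒪)` (★ `OrderedCech.refineComplexMap` ∘ ★ `Modules.pullbackSystemHom`),
  THEN for every affine family `𝓦` refining `𝓤` along `τ` and `g⁻¹𝓤` along `τ′`, `[ρ_{τ′}(g^* z)] = c₀ • [ρ_τ z]` in the raw `Ȟ²(𝓦, 𝒪)`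
  (★ `Morphisms/CechModuleH2`; no finiteness and no covering asked of `𝓦`).  Proof: finite subcover (★ `exists_fin_subcover_of_compactSpace`),
  raw → full → ordered on `𝓥` (★ `exists_rawTwo_eq`, ★ `full_d_two_eq_zero_of_mem_cechMZ2`), ★ `Modules.exists_full_d_eq_pullbackCochain_sub_smul`,
  full → raw on `WΔ` (§1), then `W″ (s,d) := W_s ∩ WΔ_d`: index independence ★ `refineC2_sub_refineC2_mem_cechMB2` twice and injectivity
  of refinement on cocycles ★ `mem_cechMB2_of_refineMC2_mem_cechMB2_of_isAffineOpen`.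

Mathlib searched (pin v4.32): `Scheme.Hom.appLE_map`, `Scheme.Hom.map_appLE_assoc`, `IsCompact.elim_finite_subcover` (via ★), `Submodule`
membership algebra (used); Mathlib has no Čech cohomology of schemes.

## References
* The Stacks Project, Tag 01FG (refinements, functoriality of the Čech complex), Tag 01FM (ordered ∕ alternating complex), Tag 01XD
  (Čech cohomology of quasi-coherent modules and affine covers). [StacksProject]
* U. Görtz, T. Wedhorn, *Algebraic Geometry II: Cohomology of Schemes* (2023), (21.16) Def. 21.71, Lemma 22.1 (p. 233), Thm. 22.9 (p. 236). [GortzWedhorn2023]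
* R. Hartshorne, *Algebraic Geometry*, GTM 52 (1977), III Lemma 4.4 and Thm. 4.5 (pp. 220–222). [Hartshorne1977]
-/

noncomputable section

set_option backward.isDefEq.respectTransparency false

open CategoryTheory CategoryTheory.Limits AlgebraicGeometry TopologicalSpace Opposite
open Literature.Algebra.Homology Literature.Algebra.Homology.OrderedCech Literature.AlgebraicGeometry.Modules

universe u

/-! ## §1 Read-outs: pull-backs of full cochains on the raw side; differences; coboundaries -/

namespace Literature.AlgebraicGeometry.Modules

section Plumbing

variable {X Y : Scheme.{u}} (g : Y ⟶ X)

/-- Composite restrictions of functions. [folklore] -/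
private theorem resFun_resFun' {U₁ U₂ U₃ : X.Opens} (h₁ : U₂ ≤ U₁) (h₂ : U₃ ≤ U₂) (x : Γ(X, U₁)) :
    X.presheaf.map (homOfLE h₂).op (X.presheaf.map (homOfLE h₁).op x) = X.presheaf.map (homOfLE (h₂.trans h₁)).op x := by
  rw [← CommRingCat.comp_apply, ← Functor.map_comp]
  rfl

/-- `(𝟙 X).appLE U V e` is the restriction map. [folklore] -/
private theorem id_appLE' {U₁ V₁ : X.Opens} (e : V₁ ≤ (𝟙 X : X ⟶ X) ⁻¹ᵁ U₁) :
    (𝟙 X : X ⟶ X).appLE U₁ V₁ e = X.presheaf.map (homOfLE e).op := by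
  rw [Scheme.Hom.appLE, Scheme.Hom.id_app, Category.id_comp]

/-- Read-out of `g.appLE` after two restrictions on the source and one on the target: it is `g.appLE` again. [folklore] -/
private theorem map_appLE_map_map_apply {U₀ U₁ U₂ : X.Opens} {V₀ V₁ W : Y.Opens} (a : U₁ ≤ U₂) (b : U₀ ≤ U₁)
    (e : V₀ ≤ g ⁻¹ᵁ U₀) (t : V₁ ≤ V₀) (e₀ : W ≤ g ⁻¹ᵁ U₂) (h : V₁ ≤ W) (x : Γ(X, U₂)) :
    Y.presheaf.map (homOfLE h).op (g.appLE U₂ W e₀ x) =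
      Y.presheaf.map (homOfLE t).op (g.appLE U₀ V₀ e (X.presheaf.map (homOfLE b).op (X.presheaf.map (homOfLE a).op x))) := by
  rw [← CommRingCat.comp_apply, Scheme.Hom.appLE_map, ← CommRingCat.comp_apply, ← CommRingCat.comp_apply,
    ← CommRingCat.comp_apply, Scheme.Hom.map_appLE_assoc, Scheme.Hom.map_appLE_assoc, Scheme.Hom.appLE_map]

/-- The same along `𝟙 X`: three restrictions compose to one. [folklore] -/
private theorem map_id_appLE_map_map_apply {U₀ U₁ U₂ V₀ V₁ : X.Opens} (a : U₁ ≤ U₂) (b : U₀ ≤ U₁)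
    (e : V₀ ≤ (𝟙 X : X ⟶ X) ⁻¹ᵁ U₀) (t : V₁ ≤ V₀) (h : V₁ ≤ U₂) (x : Γ(X, U₂)) :
    X.presheaf.map (homOfLE h).op x =
      X.presheaf.map (homOfLE t).op ((𝟙 X : X ⟶ X).appLE U₀ V₀ e
        (X.presheaf.map (homOfLE b).op (X.presheaf.map (homOfLE a).op x))) := by
  rw [id_appLE']
  erw [resFun_resFun', resFun_resFun', resFun_resFun']

end Plumbing

variable {X Y : Scheme.{u}} {ι ι' : Type} [LinearOrder ι] [LinearOrder ι'] (U : ι → X.Opens) (V : ι' → Y.Opens)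
  {A : Type u} [CommRing A] (ρ : A →+* Γ(X, ⊤)) (ρ' : A →+* Γ(Y, ⊤))
  (fX : X ⟶ Spec (.of A)) (fY : Y ⟶ Spec (.of A)) (g : Y ⟶ X) (hg : g ≫ fX = fY)

include hg in
/-- **The pull-back `Θ_θ` of full `2`-cochains along `g^♯` READS the refined raw pull-back `ρ_θ (g^* s)` of the raw cochain `s` it reads**:
`(ρ_θ(g^* s))_{jlm} = (toRing (Θ_θ c)(j,l,m))|_{V_j ∩ V_l ∩ V_m}`. [cite: StacksProject, Tag 01FG] [cite: GortzWedhorn2023, Def. 21.68 (p. 180)] -/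
theorem map_toRing_pullbackCochain_eq_refineC2_comapC2 (θ : ι' → ι) (hθ : ∀ c, V c ≤ g ⁻¹ᵁ U (θ c))
    (hρ : ∀ a, ρ' a = g.appTop (ρ a)) (c : Full.Cochain (sectionsSystem U (unitModule X) ρ) 2)
    (s : Literature.AlgebraicGeometry.Morphisms.CechMC2 fX (unitModule X) U)
    (hc : ∀ j l m, X.presheaf.map (homOfLE (inf_le_cechOpen_triple U j l m)).op (SecMod.toRing ρ (c ![j, l, m])) = s j l m)
    (j l m : ι') :
    Y.presheaf.map (homOfLE (inf_le_cechOpen_triple V j l m)).op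
        (SecMod.toRing ρ' (Full.pullbackCochain θ (pullbackSystemHom g U V θ hθ ρ ρ' hρ) 2 c ![j, l, m])) =
      Literature.AlgebraicGeometry.Morphisms.cechMRefineC2 fY (unitModule Y)
        (Literature.AlgebraicGeometry.Morphisms.preimageFamily g U) V θ hθ
        (Literature.AlgebraicGeometry.Morphisms.cechComapC2 fX fY g hg U s) j l m := by
  rw [Full.pullbackCochain_apply, toRing_pullbackSystemHom_app, toRing_sectionsSystem_map,
    (forall_toRing_eq_iff_forall_rawTwo_eq fX U ρ c s).mpr hc]
  -- the raw side is `(g^* s_{θj θl θm})|`, definitionally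
  exact (map_appLE_map_map_apply g _ _ _ _ _ _ (s (θ j) (θ l) (θ m))).symm

/-- **The pull-back of full `2`-cochains along the refinement datum of `𝟙_X` READS the raw refinement**:
`(ρ_θ s)_{jlm} = (toRing (Θ_θ c)(j,l,m))|_{V_j ∩ V_l ∩ V_m}`. [cite: StacksProject, Tag 01FG] [cite: GortzWedhorn2023, Def. 21.68 (p. 180)] -/
theorem map_toRing_pullbackCochain_id_eq_refineC2 (V₁ : ι' → X.Opens) (θ : ι' → ι) (hθ₁ : ∀ c, V₁ c ≤ (𝟙 X) ⁻¹ᵁ U (θ c))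
    (hθ : ∀ c, V₁ c ≤ U (θ c)) (hρ₁ : ∀ a, ρ a = (𝟙 X : X ⟶ X).appTop (ρ a))
    (c : Full.Cochain (sectionsSystem U (unitModule X) ρ) 2)
    (s : Literature.AlgebraicGeometry.Morphisms.CechMC2 fX (unitModule X) U)
    (hc : ∀ j l m, X.presheaf.map (homOfLE (inf_le_cechOpen_triple U j l m)).op (SecMod.toRing ρ (c ![j, l, m])) = s j l m)
    (j l m : ι') :
    X.presheaf.map (homOfLE (inf_le_cechOpen_triple V₁ j l m)).op
        (SecMod.toRing ρ (Full.pullbackCochain θ (pullbackSystemHom (𝟙 X) U V₁ θ hθ₁ ρ ρ hρ₁) 2 c ![j, l, m])) =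
      Literature.AlgebraicGeometry.Morphisms.cechMRefineC2 fX (unitModule X) U V₁ θ hθ s j l m := by
  rw [Full.pullbackCochain_apply, toRing_pullbackSystemHom_app, toRing_sectionsSystem_map,
    (forall_toRing_eq_iff_forall_rawTwo_eq fX U ρ c s).mpr hc]
  exact (map_id_appLE_map_map_apply _ _ _ _ _ (s (θ j) (θ l) (θ m))).symm

/-- **Readings are compatible with `c ↦ c − c₀ • c′`** (★ `rawTwo_sub`, ★ `rawTwo_smul`; `ρ = algebraMapΓ fX`).
[cite: GortzWedhorn2023, Def. 21.68 (p. 180)] -/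
theorem rawTwo_sub_smul (hρf : ∀ a, ρ a = Literature.AlgebraicGeometry.Morphisms.algebraMapΓ fX a) (c₀ : A)
    (c c' : Full.Cochain (sectionsSystem U (unitModule X) ρ) 2)
    (s s' : Literature.AlgebraicGeometry.Morphisms.CechMC2 fX (unitModule X) U)
    (hc : ∀ j l m, X.presheaf.map (homOfLE (inf_le_cechOpen_triple U j l m)).op (SecMod.toRing ρ (c ![j, l, m])) = s j l m)
    (hc' : ∀ j l m, X.presheaf.map (homOfLE (inf_le_cechOpen_triple U j l m)).op (SecMod.toRing ρ (c' ![j, l, m])) = s' j l m)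
    (j l m : ι) :
    X.presheaf.map (homOfLE (inf_le_cechOpen_triple U j l m)).op (SecMod.toRing ρ ((c - c₀ • c') ![j, l, m])) =
      (s - c₀ • s') j l m :=
  rawTwo_sub fX U ρ c (c₀ • c') s (c₀ • s') hc (rawTwo_smul fX U ρ hρf c₀ c' s' hc') j l m

/-- **A raw `2`-cochain read by a full COBOUNDARY is a raw coboundary** (★ `rawTwo_eq_cechMD1_of_eq_full_d`).
[cite: StacksProject, Tag 01FG] [cite: GortzWedhorn2023, Def. 21.64 (p. 179)] -/
theorem mem_cechMB2_of_forall_eq_of_full_d (w : Full.Cochain (sectionsSystem U (unitModule X) ρ) 1)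
    (s : Literature.AlgebraicGeometry.Morphisms.CechMC2 fX (unitModule X) U)
    (hc : ∀ j l m, X.presheaf.map (homOfLE (inf_le_cechOpen_triple U j l m)).op
      (SecMod.toRing ρ (((Full.complex (sectionsSystem U (unitModule X) ρ)).d 1 2).hom w ![j, l, m])) = s j l m) :
    s ∈ Literature.AlgebraicGeometry.Morphisms.cechMB2 fX (unitModule X) U := by
  have hs : s = (fun j l m => X.presheaf.map (homOfLE (inf_le_cechOpen_triple U j l m)).op
      (SecMod.toRing ρ (((Full.complex (sectionsSystem U (unitModule X) ρ)).d 1 2).hom w ![j, l, m]))) :=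
    funext fun j => funext fun l => funext fun m => (hc j l m).symm
  rw [hs]
  exact mem_cechMB2_of_eq_full_d fX U ρ w _ rfl

end Literature.AlgebraicGeometry.Modules

/-! ## §2 The transport theorem -/

namespace Literature.AlgebraicGeometry.Morphisms

/-- `X → Spec A` separated ⇒ `X` separated. [folklore] -/
private theorem isSeparated_left_of_over {A : Type u} [CommRing A] (X : Over (Spec (.of A))) [IsSeparated X.hom] :
    X.left.IsSeparated := by
  constructor
  rw [← terminal.comp_from X.hom]
  infer_instance

/-- **TRANSPORT OF A PULL-BACK SCALING IDENTITY ON `Ȟ²(𝒪)` FROM THE ORDERED COMPLEX TO RAW CLASSES.**  Let `X` be a compact separated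
`A`-scheme, `g : X → X` over `A`, `c₀ ∈ A`, `𝓤` an affine open cover.  Suppose that for every finite subfamily `𝓥 = 𝓤 ∘ e` covering `X`
and every diagonal family `WΔ ((i,j),l) = V_i ∩ V_j ∩ g⁻¹V_l`, the ORDERED module Čech classes satisfy `g^*_{↦l} x = c₀ • ref_{↦i} x` in
`Ȟ²(WΔ, 𝒪)` for all `x ∈ Ȟ²(𝓥, 𝒪)`.  Then for every raw `2`-cocycle `z` of `𝒪` on `𝓤` and every affine family `𝓦` refining `𝓤` along `τ`
and `g⁻¹𝓤` along `τ′`, `[ρ_{τ′}(g^* z)] = c₀ • [ρ_τ z]` in `Ȟ²(𝓦, 𝒪)` (raw module Čech classes; no finiteness or covering asked of `𝓦`).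
[cite: StacksProject, Tags 01FG, 01FM, 01XD] [cite: GortzWedhorn2023, Thm. 22.9 (p. 236)] -/
theorem CechMH2.mk_refineC2_comapC2_eq_smul_of_ordered
    {A : Type} [CommRing A] (X : Over (Spec (.of A))) [IsSeparated X.hom] [CompactSpace X.left]
    (g : X.left ⟶ X.left) (hg : g ≫ X.hom = X.hom) (c₀ : A)
    {ι : Type} (U : ι → X.left.affineOpens) (hU : ⨆ j, (U j).1 = ⊤)
    (hOrd : ∀ (m : ℕ) (e : Fin m → ι) (_ : ⨆ i, (U (e i)).1 = ⊤) (WΔ : (Fin m ×ₗ Fin m) ×ₗ Fin m → X.left.affineOpens)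
      (_ : ∀ i j l, (WΔ (toLex (toLex (i, j), l))).1 = (U (e i)).1 ⊓ (U (e j)).1 ⊓ g ⁻¹ᵁ (U (e l)).1)
      (hl : ∀ d, (WΔ d).1 ≤ g ⁻¹ᵁ (U (e (ofLex d).2)).1)
      (hi : ∀ d, (WΔ d).1 ≤ (𝟙 X.left) ⁻¹ᵁ (U (e (ofLex (ofLex d).1).1)).1)
      (hρg : ∀ a, scalarRingHomTop X a = g.appTop (scalarRingHomTop X a))
      (hρ1 : ∀ a, scalarRingHomTop X a = (𝟙 X.left : X.left ⟶ X.left).appTop (scalarRingHomTop X a))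
      (x : (cechComplex (fun i => (U (e i)).1) (unitModule X.left) (scalarRingHomTop X)).homology ((2 : ℕ) : ℤ)),
      ((HomologicalComplex.homologyMap (refineComplexMap (fun d => (ofLex d).2)
          (pullbackSystemHom g (fun i => (U (e i)).1) (fun d => (WΔ d).1) (fun d => (ofLex d).2) hl
            (scalarRingHomTop X) (scalarRingHomTop X) hρg)) ((2 : ℕ) : ℤ)).hom :
          (cechComplex (fun i => (U (e i)).1) (unitModule X.left) (scalarRingHomTop X)).homology ((2 : ℕ) : ℤ) →ₗ[A]
            (cechComplex (fun d => (WΔ d).1) (unitModule X.left) (scalarRingHomTop X)).homology ((2 : ℕ) : ℤ)) x =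
        c₀ • ((HomologicalComplex.homologyMap (refineComplexMap (fun d => (ofLex (ofLex d).1).1)
          (pullbackSystemHom (𝟙 X.left) (fun i => (U (e i)).1) (fun d => (WΔ d).1) (fun d => (ofLex (ofLex d).1).1) hi
            (scalarRingHomTop X) (scalarRingHomTop X) hρ1)) ((2 : ℕ) : ℤ)).hom :
          (cechComplex (fun i => (U (e i)).1) (unitModule X.left) (scalarRingHomTop X)).homology ((2 : ℕ) : ℤ) →ₗ[A]
            (cechComplex (fun d => (WΔ d).1) (unitModule X.left) (scalarRingHomTop X)).homology ((2 : ℕ) : ℤ)) x)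
    (z : cechMZ2 X.hom (SheafOfModules.unit X.left.ringCatSheaf) (fun j => (U j).1))
    {κ : Type} (W : κ → X.left.affineOpens) (τ τ' : κ → ι)
    (hτ : ∀ s, (W s).1 ≤ (U (τ s)).1) (hτ' : ∀ s, (W s).1 ≤ g ⁻¹ᵁ (U (τ' s)).1) :
    CechMH2.mk X.hom (SheafOfModules.unit X.left.ringCatSheaf) (fun s => (W s).1)
        ⟨cechMRefineC2 X.hom (SheafOfModules.unit X.left.ringCatSheaf) (preimageFamily g (fun j => (U j).1))
            (fun s => (W s).1) τ' hτ'
            (cechComapC2 X.hom X.hom g hg (fun j => (U j).1)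
              (z : CechMC2 X.hom (SheafOfModules.unit X.left.ringCatSheaf) (fun j => (U j).1))),
          refineMC2_mem_cechMZ2 X.hom (SheafOfModules.unit X.left.ringCatSheaf) (preimageFamily g (fun j => (U j).1))
            (fun s => (W s).1) τ' hτ' (comapC2_mem_cechMZ2 X.hom X.hom g hg (fun j => (U j).1) z.2)⟩ =
      c₀ • CechMH2.mk X.hom (SheafOfModules.unit X.left.ringCatSheaf) (fun s => (W s).1)
        ⟨cechMRefineC2 X.hom (SheafOfModules.unit X.left.ringCatSheaf) (fun j => (U j).1) (fun s => (W s).1) τ hτ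
            (z : CechMC2 X.hom (SheafOfModules.unit X.left.ringCatSheaf) (fun j => (U j).1)),
          refineMC2_mem_cechMZ2 X.hom (SheafOfModules.unit X.left.ringCatSheaf) (fun j => (U j).1) (fun s => (W s).1) τ hτ
            z.2⟩ := by
  classical
  haveI : X.left.IsSeparated := isSeparated_left_of_over X
  -- (S1) class identity ⇐ difference of the representatives is a raw coboundary
  rw [← map_smul, CechMH2.mk_eq_mk_iff, Submodule.coe_smul]
  -- (S2) a finite subcover `V := U ∘ e`
  obtain ⟨m, e, he⟩ := Literature.AlgebraicGeometry.AbelianSchemes.exists_fin_subcover_of_compactSpace (fun j => (U j).1) hU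
  -- (S3) the diagonal family of `g` on `V`
  obtain ⟨WΔ, hWΔ⟩ := Literature.AlgebraicGeometry.AbelianSchemes.exists_diagonalCover (Z := X) (fun i => U (e i)) g
  have hl := Literature.AlgebraicGeometry.AbelianSchemes.diagonalCover_le_preimage (fun i => U (e i)) g WΔ hWΔ
  have hi := Literature.AlgebraicGeometry.AbelianSchemes.diagonalCover_le_fst (fun i => U (e i)) g WΔ hWΔ
  have hi' : ∀ d, (WΔ d).1 ≤ (U (e (ofLex (ofLex d).1).1)).1 :=
    Literature.AlgebraicGeometry.AbelianSchemes.diagonalCover_le (fun i => U (e i)) g WΔ hWΔ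
  have hΔcov : ⨆ d, (WΔ d).1 = ⊤ :=
    Literature.AlgebraicGeometry.AbelianSchemes.iSup_diagonalCover_eq_top (fun i => U (e i)) g WΔ hWΔ he
  have hρg : ∀ a, scalarRingHomTop X a = g.appTop (scalarRingHomTop X a) := fun a => by
    rw [scalarRingHomTop_apply]
    conv_lhs => rw [← hg]
    rw [Scheme.Hom.comp_appTop]
    rfl
  have hρ1 : ∀ a, scalarRingHomTop X a = (𝟙 X.left : X.left ⟶ X.left).appTop (scalarRingHomTop X a) := fun a => by simp
  -- (S4) the raw cocycle `zV := ρ_e z` on `V`, read by a full cocycle `cF`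
  have hzV : cechMRefineC2 X.hom (SheafOfModules.unit X.left.ringCatSheaf) (fun j => (U j).1) (fun i => (U (e i)).1) e
      (fun _ => le_rfl) (z : CechMC2 X.hom (SheafOfModules.unit X.left.ringCatSheaf) (fun j => (U j).1)) ∈
      cechMZ2 X.hom (SheafOfModules.unit X.left.ringCatSheaf) (fun i => (U (e i)).1) :=
    refineMC2_mem_cechMZ2 _ _ _ _ _ _ z.2
  obtain ⟨cF, hcF⟩ := exists_rawTwo_eq X.hom (fun i => (U (e i)).1) (scalarRingHomTop X)
    (cechMRefineC2 X.hom (SheafOfModules.unit X.left.ringCatSheaf) (fun j => (U j).1) (fun i => (U (e i)).1) e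
      (fun _ => le_rfl) (z : CechMC2 X.hom (SheafOfModules.unit X.left.ringCatSheaf) (fun j => (U j).1)))
  have hdc := full_d_two_eq_zero_of_mem_cechMZ2 X.hom (fun i => (U (e i)).1) (scalarRingHomTop X) cF _ hzV hcF
  -- (S5)+(S6) the ordered identity ⇒ `Θ_l cF − c₀ • Θ_i cF` is a full coboundary on `WΔ`
  have hVa : ∀ s : Finset (Fin m), s.Nonempty → IsAffineOpen (cechOpen (fun i => (U (e i)).1) s) :=
    fun s hs => isAffineOpen_cechOpen_of_nonempty (fun i => U (e i)) hs
  have hΔa : ∀ s : Finset ((Fin m ×ₗ Fin m) ×ₗ Fin m), s.Nonempty → IsAffineOpen (cechOpen (fun d => (WΔ d).1) s) :=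
    fun s hs => isAffineOpen_cechOpen_of_nonempty WΔ hs
  obtain ⟨w', hw'⟩ := exists_full_d_eq_pullbackCochain_sub_smul (fun i => (U (e i)).1) (fun d => (WΔ d).1)
    (unitModule X.left) (unitModule X.left) (scalarRingHomTop X) (scalarRingHomTop X) hVa he IsAffineLocalizing.unit hΔa hΔcov
    IsAffineLocalizing.unit (fun d => (ofLex d).2) (fun d => (ofLex (ofLex d).1).1)
    (pullbackSystemHom g (fun i => (U (e i)).1) (fun d => (WΔ d).1) (fun d => (ofLex d).2) hl
      (scalarRingHomTop X) (scalarRingHomTop X) hρg)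
    (pullbackSystemHom (𝟙 X.left) (fun i => (U (e i)).1) (fun d => (WΔ d).1) (fun d => (ofLex (ofLex d).1).1) hi
      (scalarRingHomTop X) (scalarRingHomTop X) hρ1)
    c₀ (fun x => hOrd m e he WΔ hWΔ hl hi hρg hρ1 x) cF hdc
  -- (S7) read back on `WΔ`: `DΔ := ρ_l (g^* zV) − c₀ • ρ_i zV` is a raw coboundary
  have hDΔ : cechMRefineC2 X.hom (SheafOfModules.unit X.left.ringCatSheaf) (preimageFamily g (fun i => (U (e i)).1))
        (fun d => (WΔ d).1) (fun d => (ofLex d).2) hl (cechComapC2 X.hom X.hom g hg (fun i => (U (e i)).1)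
          (cechMRefineC2 X.hom (SheafOfModules.unit X.left.ringCatSheaf) (fun j => (U j).1) (fun i => (U (e i)).1) e
            (fun _ => le_rfl) (z : CechMC2 X.hom (SheafOfModules.unit X.left.ringCatSheaf) (fun j => (U j).1)))) -
      c₀ • cechMRefineC2 X.hom (SheafOfModules.unit X.left.ringCatSheaf) (fun i => (U (e i)).1) (fun d => (WΔ d).1)
        (fun d => (ofLex (ofLex d).1).1) hi'
          (cechMRefineC2 X.hom (SheafOfModules.unit X.left.ringCatSheaf) (fun j => (U j).1) (fun i => (U (e i)).1) e
            (fun _ => le_rfl) (z : CechMC2 X.hom (SheafOfModules.unit X.left.ringCatSheaf) (fun j => (U j).1))) ∈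
      cechMB2 X.hom (SheafOfModules.unit X.left.ringCatSheaf) (fun d => (WΔ d).1) := by
    refine mem_cechMB2_of_forall_eq_of_full_d (fun d => (WΔ d).1) (scalarRingHomTop X) X.hom w' _ fun j l m => ?_
    rw [hw']
    exact rawTwo_sub_smul (fun d => (WΔ d).1) (scalarRingHomTop X) X.hom (fun _ => rfl) c₀ _ _ _ _
      (fun j l m => map_toRing_pullbackCochain_eq_refineC2_comapC2 (fun i => (U (e i)).1) (fun d => (WΔ d).1)
        (scalarRingHomTop X) (scalarRingHomTop X) X.hom X.hom g hg _ hl hρg cF _ hcF j l m)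
      (fun j l m => map_toRing_pullbackCochain_id_eq_refineC2 (fun i => (U (e i)).1) (scalarRingHomTop X) X.hom
        (fun d => (WΔ d).1) (fun d => (ofLex (ofLex d).1).1) hi hi' hρ1 cF _ hcF j l m) j l m
  -- (S8) transport to `𝓦` through `W₂ (s, d) := W_s ∩ WΔ_d`
  have hcovW₂ : ∀ s, (W s).1 ≤ ⨆ p : κ × ((Fin m ×ₗ Fin m) ×ₗ Fin m), (W p.1).1 ⊓ (WΔ p.2).1 := fun s x hx => by
    have hx' : x ∈ (⊤ : X.left.Opens) := trivial
    rw [← hΔcov] at hx'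
    obtain ⟨d, hd⟩ := Opens.mem_iSup.mp hx'
    exact Opens.mem_iSup.mpr ⟨(s, d), ⟨hx, hd⟩⟩
  -- the two refinements of `g^* z` to `W₂`, and the two of `z`, differ by coboundaries (★ N2)
  have n2a := refineC2_sub_refineC2_mem_cechMB2 X.hom (SheafOfModules.unit X.left.ringCatSheaf)
    (preimageFamily g (fun j => (U j).1)) (fun p : κ × ((Fin m ×ₗ Fin m) ×ₗ Fin m) => (W p.1).1 ⊓ (WΔ p.2).1)
    (e ∘ (fun d : (Fin m ×ₗ Fin m) ×ₗ Fin m => (ofLex d).2) ∘ Prod.snd) (τ' ∘ Prod.fst)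
    (fun p => (inf_le_right.trans (hl p.2))) (fun p => inf_le_left.trans (hτ' p.1))
    (comapC2_mem_cechMZ2 X.hom X.hom g hg (fun j => (U j).1) z.2)
  have n2b := refineC2_sub_refineC2_mem_cechMB2 X.hom (SheafOfModules.unit X.left.ringCatSheaf)
    (fun j => (U j).1) (fun p : κ × ((Fin m ×ₗ Fin m) ×ₗ Fin m) => (W p.1).1 ⊓ (WΔ p.2).1)
    (e ∘ (fun d : (Fin m ×ₗ Fin m) ×ₗ Fin m => (ofLex (ofLex d).1).1) ∘ Prod.snd) (τ ∘ Prod.fst)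
    (fun p => (inf_le_right.trans (hi' p.2))) (fun p => inf_le_left.trans (hτ p.1)) z.2
  -- `ρ_{snd} DΔ ∈ B²(W₂)`, rewritten as refinements straight from `𝓤` and `g⁻¹𝓤`
  have h1 := refineMC2_mem_cechMB2 X.hom (SheafOfModules.unit X.left.ringCatSheaf) (fun d => (WΔ d).1)
    (fun p : κ × ((Fin m ×ₗ Fin m) ×ₗ Fin m) => (W p.1).1 ⊓ (WΔ p.2).1) Prod.snd (fun p => inf_le_right) hDΔ
  rw [map_sub, map_smul, cechComapC2_refineC2, cechMRefineC2_refineC2, cechMRefineC2_refineC2,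
    cechMRefineC2_refineC2, cechMRefineC2_refineC2] at h1
  -- the target, refined to `W₂`
  have h2 : cechMRefineC2 X.hom (SheafOfModules.unit X.left.ringCatSheaf) (fun s => (W s).1)
      (fun p : κ × ((Fin m ×ₗ Fin m) ×ₗ Fin m) => (W p.1).1 ⊓ (WΔ p.2).1) Prod.fst (fun p => inf_le_left)
      (cechMRefineC2 X.hom (SheafOfModules.unit X.left.ringCatSheaf) (preimageFamily g (fun j => (U j).1)) (fun s => (W s).1) τ' hτ'
          (cechComapC2 X.hom X.hom g hg (fun j => (U j).1)
            (z : CechMC2 X.hom (SheafOfModules.unit X.left.ringCatSheaf) (fun j => (U j).1))) -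
        c₀ • cechMRefineC2 X.hom (SheafOfModules.unit X.left.ringCatSheaf) (fun j => (U j).1) (fun s => (W s).1) τ hτ
          (z : CechMC2 X.hom (SheafOfModules.unit X.left.ringCatSheaf) (fun j => (U j).1))) ∈
      cechMB2 X.hom (SheafOfModules.unit X.left.ringCatSheaf)
        (fun p : κ × ((Fin m ×ₗ Fin m) ×ₗ Fin m) => (W p.1).1 ⊓ (WΔ p.2).1) := by
    rw [map_sub, map_smul, cechMRefineC2_refineC2, cechMRefineC2_refineC2]
    have n2b' := Submodule.smul_mem _ c₀ n2b
    rw [smul_sub] at n2b'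
    have key := Submodule.add_mem _ (Submodule.sub_mem _ h1 n2a) n2b'
    convert key using 1
    abel
  -- injectivity of `Ȟ²(𝓦) → Ȟ²(W₂)` on cocycles (`𝓦` affine, `𝒪` affine-localizing, `W₂` covers each `W_s`)
  refine mem_cechMB2_of_refineMC2_mem_cechMB2_of_isAffineOpen X.hom (SheafOfModules.unit X.left.ringCatSheaf)
    (fun s => (W s).1) (fun p : κ × ((Fin m ×ₗ Fin m) ×ₗ Fin m) => (W p.1).1 ⊓ (WΔ p.2).1) Prod.fst (fun p => inf_le_left)
    IsAffineLocalizing.unit (fun s => (W s).2) hcovW₂ ?_ h2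
  exact Submodule.sub_mem _ (refineMC2_mem_cechMZ2 _ _ _ _ _ _ (comapC2_mem_cechMZ2 X.hom X.hom g hg _ z.2))
    (Submodule.smul_mem _ c₀ (refineMC2_mem_cechMZ2 _ _ _ _ _ _ z.2))

end Literature.AlgebraicGeometry.Morphisms

end
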